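import Mathlib
import HarnessLib
import Summits.Langlands.Langlands.Theses.SkinnerWilesDefectOne
import Summits.Langlands.Langlands.Theorems.SkinnerWilesDefectOneReducibleOrdinaryProModularDefs
import Summits.Langlands.Langlands.Theorems.SkinnerWilesDefectOneReducibleOrdinaryProModularFineSelmerDefs
import Summits.Langlands.Langlands.Theorems.SkinnerWilesDefectOneProModularOfEisensteinSeedPointsOverOE
import Summits.Langlands.Langlands.Theorems.SkinnerWilesDefectOneProModularOfEisensteinSeedIrreduciblePoint
import Summits.Langlands.Langlands.Theorems.SkinnerWilesDefectOneReducibleOrdinaryProModularSmallReducibleSteinbergLocusThinAux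
import Literature.NumberTheory.GaloisRepresentations.NearlyOrdinaryDeformationRing
import Literature.NumberTheory.GaloisRepresentations.PadicIntermediateFieldIntegers
import Literature.NumberTheory.GaloisRepresentations.LocalKroneckerWeberInertiaProofs
import Literature.NumberTheory.EllipticCurves.KernelReductionTateFormInertiaProofs
import Literature.NumberTheory.EllipticCurves.EisensteinNewformLevelRaisingInertiaProofs
import Literature.RingTheory.KrullDimension.AffineDimension

/-!
# Stub (P2) `stub_seedPatchingPrime`, realised sub-case: the kernel of an `𝒪_L`-valued point of `R_𝒟`
# realising an irreducible, `p`-adically automorphic, ordinary `r` is a pro-modular PATCHING prime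

Route `SkinnerWilesDefectOne`, crux `ReducibleOrdinaryProModular` (stmt-Langlands-12919), line
`fine-selmer-codimension-two` (lead skeleton v3, `Cruxes/ReducibleOrdinaryProModular/Lines/fine_selmer_codimension_two.lean`),
stub (P2) `stub_seedPatchingPrime` ("the seed's point is a pro-modular patching prime of `R_𝒟`", Skinner–Wiles
step (II) + [SW, Prop. 4.2]).  This file proves its REALISED SUB-CASE, registered as the sub-goal
`stub_seedPatchingPrime_auxRealised`: once the seed's representation `r` is realised, up to `GL₂(ℚ̄_p)`-conjugation,
by an `𝒪_L`-valued point `ψ : R_𝒟 → 𝒪_L` of the model's universal ring (`L/ℚ_p` finite inside `ℚ̄_p`, `𝒪_L`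
integral over `ψ(R_𝒟)` — automatic for an `𝒪`-algebra point with `𝒪_L ⊇ 𝒪` finite), the prime `𝔭 = ker ψ`
is a PATCHING prime (`IsPatchingPrime`: `dim R_𝒟/𝔭 = 1`, `𝔭 ∉ Z^red`, the nearly-ordinary ratio
`ψ₁⁽ᵛ⁾/ψ₂⁽ᵛ⁾ mod 𝔭` of infinite order at every `v ∣ p`) which is pro-modular at the seed's level
(`IsProModularPrime`).  What is left to the full stub is exactly Skinner–Wiles' transport of the residual
extension class / coefficient enlargement producing such a `ψ` on the model of `(ρ, ρ₀)`.  Sorry-free: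

* `exists_mem_absInertia_forall_cyclotomicCharacter_pow_ne_one` — the `p`-adic cyclotomic character has
  infinite order on the inertia group of `Γ_{F_v}`, `v ∣ p` (from the tree's global statement at a prime
  `𝔓 ∣ v` of `ℤ̄_F` and the lifting of `I_𝔓` to `I_{F_v}`; Serre, *Abelian ℓ-adic representations*, I.1.2);
* `ringKrullDim_quotient_ker_eq_one_of_isIntegral` — DIMENSION ONE: `R/ker ψ ↪ 𝒪_L` is an injective integral
  extension of domains, so `dim R/ker ψ = dim 𝒪_L = 1` (going up + incomparability, tree
  `ringKrullDim_eq_of_isIntegral`; `𝒪_L` a principal ideal domain, not a field);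
* `not_isOfFinOrder_ratio_mod_ker` — INFINITE ORDER: if `φ : R_𝒟 → ℚ̄_p` realises `r` and `r|_{Γ_{F_v}}` is
  upper triangular in a frame `Q` with inertial diagonal `(θ₁, θ₂)`, `θ₂^m = 1`, `θ₁^m = ε^{(k-1)m}`, `k ≥ 2`,
  then `ψ₁⁽ᵛ⁾/ψ₂⁽ᵛ⁾ mod ker φ` has infinite order: `φ ∘ (ψ₁⁽ᵛ⁾, ψ₂⁽ᵛ⁾)` is the diagonal of `r` in the Borel
  frame `P · φ(noFrame v)`, equal to `(θ₁, θ₂)` UP TO ORDER (landed `diag_eq_or_eq_swap_of_conj`), and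
  `ε|_{I_{F_v}}` has infinite order;
* `isPatchingPrime_ker_and_isProModularPrimeAt_ker` (sharp form, prime and level named) and the registered
  `stub_seedPatchingPrime_auxRealised` — assembled with the landed ENTRANCE
  `isProModularPrimeAt_ker_of_isPadicallyAutomorphic_intermediateFieldIntegers` ([SW, §4.1 p. 62]) and the
  landed `Theorems.not_mem_reducibleLocus_ker` (irreducibility of `r` ⇒ `ker φ ∉ Z^red`).

References: C. M. Skinner, A. J. Wiles, *Residually reducible representations and modular forms*, Publ. Math.
IHÉS 89 (1999) 5–126, §2.3 (nice deformations), §4.1 (pro-modular primes, p. 62), §4.2 [SkinnerWiles1999];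
J.-P. Serre, *Abelian ℓ-adic representations and elliptic curves* (1968), Ch. I §1.2 [SerreAbelianLadic1968];
H. Matsumura, *Commutative Ring Theory* (1986), Thm. 9.4 [Matsumura1987].
-/

set_option linter.dupNamespace false -- project-wide option (lakefile weak.linter.dupNamespace); `Summit.Langlands.Langlands` is the mandated namespace

namespace Summit.Langlands.Langlands.Cruxes.ReducibleOrdinaryProModular.FineSelmerCodimensionTwo

open scoped NumberField MatrixGroups
open Filter NumberField IsDedekindDomain Field Matrix
open Literature.NumberTheory.Automorphic Literature.NumberTheory.Automorphic.BigHeckeGLn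
open Literature.NumberTheory.GaloisRepresentations
open Summit.Langlands.Langlands.Theses.SkinnerWilesDefectOne
open Summit.Langlands.Langlands.Cruxes.ReducibleOrdinaryProModular.SteinbergHyperplane

noncomputable section

/-! ### 1. The cyclotomic character has infinite order on the local inertia group at `v ∣ p` -/

/-- **Some `σ` in the inertia group `I_{F_v}` of the local Galois group at `v ∣ p` has `χ_p(σ)ⁱ ≠ 1` for all
`i ≥ 1`** (the `p`-adic cyclotomic character has infinite order on `I_{F_v}`): the global statement
`exists_mem_inertia_forall_cyclotomicCharacter_pow_ne_one` (`τ ∈ I_𝔓`, `𝔓 ∣ v`, with `χ_p(τ) = (1+p)ʲ`,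
`j ≥ 1`) at the prime `𝔓` cut out by the chosen embedding `F̄ → F̄_v`, whose inertia group is the image of
`I_{F_v}` (`Hida2000Thm326.exists_primesAbove_forall_inertia_absGaloisRestrict`), and `χ_p ∘ res = χ_p`
(`cyclotomicCharacter_absGaloisRestrict`). [cite: SerreAbelianLadic1968, I.1.2] -/
theorem exists_mem_absInertia_forall_cyclotomicCharacter_pow_ne_one (F : Type) [Field F] [NumberField F]
    (p : ℕ) [Fact p.Prime] (v : HeightOneSpectrum (𝓞 F)) (hv : (p : 𝓞 F) ∈ v.asIdeal) :
    ∃ σ ∈ absInertia (v.adicCompletion F),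
      ∀ i : ℕ, 0 < i → GaloisRep.cyclotomicCharacter (v.adicCompletion F) p σ ^ i ≠ 1 := by
  obtain ⟨𝔓, h𝔓, honto, -⟩ :=
    Literature.NumberTheory.EllipticCurves.Hida2000Thm326.exists_primesAbove_forall_inertia_absGaloisRestrict F v
  obtain ⟨τ, hτ, hpow⟩ := exists_mem_inertia_forall_cyclotomicCharacter_pow_ne_one p hv h𝔓
  obtain ⟨σ, hσ, hστ⟩ := honto τ hτ
  refine ⟨σ, hσ, fun i hi => ?_⟩
  haveI : NeZero (p : F) := ⟨Nat.cast_ne_zero.mpr (Fact.out : p.Prime).ne_zero⟩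
  rw [← cyclotomicCharacter_absGaloisRestrict F (v.adicCompletion F) p σ, hστ]
  exact hpow i hi

/-! ### 2. Dimension one: `R / ker ψ ↪ 𝒪_L` integral -/

/-- **An integral `𝒪_L`-valued point has a dimension-one kernel.**  For ANY commutative ring `R` and a ring
homomorphism `ψ : R → 𝒪_L` (`L/ℚ_p` finite inside `ℚ̄_p`) over which `𝒪_L` is INTEGRAL, the domain
`R / ker ψ` embeds into the discrete valuation ring `𝒪_L` with `𝒪_L` integral over it, so
`dim (R / ker ψ) = dim 𝒪_L = 1` (going up and incomparability, tree `ringKrullDim_eq_of_isIntegral`;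
`𝒪_L` is a principal ideal domain which is not a field, tree `PadicIntermediateFieldIntegers`).
[cite: Matsumura1987, Thm 9.4] -/
theorem ringKrullDim_quotient_ker_eq_one_of_isIntegral {R : Type*} [CommRing R] {p : ℕ} [Fact p.Prime]
    (L : IntermediateField ℚ_[p] (PadicAlgCl p)) [FiniteDimensional ℚ_[p] L]
    (ψ : R →+* intermediateFieldIntegers p L) (hint : ψ.IsIntegral) :
    ringKrullDim (R ⧸ RingHom.ker ψ) = 1 := by
  letI : Algebra (R ⧸ RingHom.ker ψ) (intermediateFieldIntegers p L) := (RingHom.kerLift ψ).toAlgebra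
  haveI : Algebra.IsIntegral (R ⧸ RingHom.ker ψ) (intermediateFieldIntegers p L) := by
    have hcomp : (RingHom.kerLift ψ).comp (Ideal.Quotient.mk (RingHom.ker ψ)) = ψ :=
      RingHom.ext fun r => RingHom.kerLift_mk ψ r
    have h : (RingHom.kerLift ψ).IsIntegral :=
      RingHom.IsIntegral.tower_top (Ideal.Quotient.mk (RingHom.ker ψ)) (RingHom.kerLift ψ) (hcomp ▸ hint)
    exact ⟨h⟩
  have hinj : Function.Injective (algebraMap (R ⧸ RingHom.ker ψ) (intermediateFieldIntegers p L)) :=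
    RingHom.kerLift_injective ψ
  rw [Literature.RingTheory.KrullDimension.ringKrullDim_eq_of_isIntegral hinj]
  exact IsPrincipalIdealRing.ringKrullDim_eq_one _ fun hf =>
    intermediateFieldIntegers.maximalIdeal_ne_bot L (IsLocalRing.isField_iff_maximalIdeal_eq.mp hf)

/-! ### 3. Infinite order of the nearly-ordinary inertial ratio at an ordinary point -/

section Ratio

variable {F : Type} [Field F] [NumberField F] {p : ℕ} [Fact p.Prime]
variable {𝒪 : Type} [CommRing 𝒪] {k : Type} [Field k] [Algebra 𝒪 k] {𝒟 : NearlyOrdinaryDatum F p 𝒪 k}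
variable (𝓡 : NearlyOrdinaryDeformationRing.{0} 𝒟)

/-- **The universal ratio `ψ₁⁽ᵛ⁾/ψ₂⁽ᵛ⁾` has infinite order modulo the kernel of an ordinary point of weight
`k ≥ 2`.**  Let `φ : R_𝒟 → ℚ̄_p` realise `r : Γ_F → GL₂(ℚ̄_p)` up to conjugation (`φ ∘ ρ_𝒟 = P⁻¹ r P`) and
let `r|_{Γ_{F_v}}` be upper triangular in some frame `Q` with diagonal `(θ₁, θ₂)`, `θ₂^m = 1` and
`θ₁^m = ε^{(k-1)m}` on the inertia group (`k ≥ 2`, `m ≥ 1`).  Then `ψ₁⁽ᵛ⁾/ψ₂⁽ᵛ⁾ mod ker φ` is not of finite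
order.  Proof: if its `n`-th power were trivial, then `φ(ψ₁⁽ᵛ⁾(σ))ⁿ = φ(ψ₂⁽ᵛ⁾(σ))ⁿ` for all `σ`; but
`(φ ψ₁⁽ᵛ⁾(σ), φ ψ₂⁽ᵛ⁾(σ))` is the diagonal of `r(σ)` in the Borel frame `P · φ(noFrame v)`, hence equals
`(θ₁(σ), θ₂(σ))` up to order (`diag_eq_or_eq_swap_of_conj`: two upper-triangular forms of one matrix have the
same diagonal multiset), so `θ₁(σ)ⁿ = θ₂(σ)ⁿ` and on inertia `ε(σ)^{(k-1)mn} = 1` for all `σ ∈ I_{F_v}` —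
contradicting `exists_mem_absInertia_forall_cyclotomicCharacter_pow_ne_one`.
[cite: SkinnerWiles1999, §2.3 and §4.2] -/
theorem not_isOfFinOrder_ratio_mod_ker (φ : 𝓡.R →+* PadicAlgCl p) (r : FramedGaloisRep F (PadicAlgCl p) 2)
    (P : GL (Fin 2) (PadicAlgCl p)) (hreal : ∀ g, Matrix.GeneralLinearGroup.map φ (𝓡.ρ g) = P⁻¹ * r g * P)
    {k' m : ℕ} (hk : 2 ≤ k') (hm : 0 < m) (v : HeightOneSpectrum (𝓞 F)) (hv : (p : 𝓞 F) ∈ v.asIdeal)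
    (Q : GL (Fin 2) (PadicAlgCl p))
    (hQ : ∀ σ, (Q⁻¹ * r.toLocal v σ * Q).val 1 0 = 0 ∧ (σ ∈ absInertia (v.adicCompletion F) →
      (Q⁻¹ * r.toLocal v σ * Q).val 1 1 ^ m = 1 ∧ (Q⁻¹ * r.toLocal v σ * Q).val 0 0 ^ m =
        algebraMap (Padic p) (PadicAlgCl p) (((GaloisRep.cyclotomicCharacter (v.adicCompletion F) p σ).val :
          PadicInt p) : Padic p) ^ ((k' - 1) * m))) :
    ¬ IsOfFinOrder ((Units.map (Ideal.Quotient.mk (RingHom.ker φ) : 𝓡.R →* 𝓡.R ⧸ RingHom.ker φ)).comp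
        (𝓡.subChar v hv / 𝓡.quotChar v hv)) := by
  intro hfin
  obtain ⟨σ, hσI, hσ⟩ := exists_mem_absInertia_forall_cyclotomicCharacter_pow_ne_one F p v hv
  obtain ⟨n, hn, hfn⟩ := isOfFinOrder_iff_pow_eq_one.mp hfin
  -- (1) evaluate the finite-order identity at `σ` and push it through `φ`
  have h1 := DFunLike.congr_fun hfn σ
  rw [MonoidHom.pow_apply, MonoidHom.one_apply, MonoidHom.comp_apply, MonoidHom.div_apply, map_div, div_pow,
    div_eq_one, Units.ext_iff, Units.val_pow_eq_pow_val, Units.val_pow_eq_pow_val, Units.coe_map,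
    Units.coe_map, MonoidHom.coe_coe, NearlyOrdinaryDeformationRing.coe_subChar_apply,
    NearlyOrdinaryDeformationRing.coe_quotChar_apply, ← map_pow, ← map_pow, Ideal.Quotient.eq,
    RingHom.mem_ker, map_sub, sub_eq_zero, map_pow, map_pow] at h1
  -- h1 : φ a ^ n = φ d ^ n
  -- (2) the Borel frame `B = P · φ(noFrame v)` of `r|_{Γ_{F_v}}`
  set σ' := absGaloisRestrict F (v.adicCompletion F) σ with hσ'
  set B : GL (Fin 2) (PadicAlgCl p) := P * Matrix.GeneralLinearGroup.map φ (𝓡.noFrame v) with hB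
  have hconj : Matrix.GeneralLinearGroup.map φ (𝓡.localRep v σ) = B⁻¹ * r σ' * B := by
    rw [NearlyOrdinaryDeformationRing.localRep_apply, map_mul, map_mul, map_inv, hreal, hB, ← hσ']
    group
  have hup : (B⁻¹ * r σ' * B).val 1 0 = 0 := by
    rw [← hconj]
    change φ ((𝓡.localRep v σ).val 1 0) = 0
    rw [𝓡.localRep_lowerLeft v hv σ, map_zero]
  have ha : (B⁻¹ * r σ' * B).val 0 0 = φ ((𝓡.localRep v σ).val 0 0) := by rw [← hconj]; rfl
  have hd : (B⁻¹ * r σ' * B).val 1 1 = φ ((𝓡.localRep v σ).val 1 1) := by rw [← hconj]; rfl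
  -- (3) compare with the ordinary frame `Q`
  obtain ⟨hQ10, hQI⟩ := hQ σ
  obtain ⟨hθ2, hθ1⟩ := hQI hσI
  rw [FramedGaloisRep.toLocal_apply] at hQ10 hθ2 hθ1
  have key : (Q⁻¹ * r σ' * Q).val 0 0 ^ n = (Q⁻¹ * r σ' * Q).val 1 1 ^ n := by
    rcases diag_eq_or_eq_swap_of_conj (r σ') B Q hup hQ10 with ⟨h0, h1'⟩ | ⟨h0, h1'⟩
    · rw [← h0, ← h1', ha, hd]; exact h1
    · rw [← h0, ← h1', ha, hd]; exact h1.symm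
  -- (4) on inertia: `ε(σ)^{(k'-1) m n} = 1`
  set c : PadicAlgCl p := algebraMap (Padic p) (PadicAlgCl p)
    (((GaloisRep.cyclotomicCharacter (v.adicCompletion F) p σ).val : PadicInt p) : Padic p) with hc
  have hcpow : c ^ ((k' - 1) * m * n) = 1 := by
    calc c ^ ((k' - 1) * m * n) = (c ^ ((k' - 1) * m)) ^ n := pow_mul c _ n
      _ = ((Q⁻¹ * r σ' * Q).val 0 0 ^ m) ^ n := by rw [hθ1]
      _ = ((Q⁻¹ * r σ' * Q).val 0 0 ^ n) ^ m := by rw [← pow_mul, ← pow_mul, mul_comm]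
      _ = ((Q⁻¹ * r σ' * Q).val 1 1 ^ n) ^ m := by rw [key]
      _ = ((Q⁻¹ * r σ' * Q).val 1 1 ^ m) ^ n := by rw [← pow_mul, ← pow_mul, mul_comm]
      _ = 1 := by rw [hθ2, one_pow]
  have hN : 0 < (k' - 1) * m * n := Nat.mul_pos (Nat.mul_pos (by omega) hm) hn
  apply hσ ((k' - 1) * m * n) hN
  rw [hc, ← map_pow, map_eq_one_iff _ (algebraMap (Padic p) (PadicAlgCl p)).injective] at hcpow
  refine Units.ext (PadicInt.ext ?_)
  rw [Units.val_pow_eq_pow_val, Units.val_one, PadicInt.coe_pow, PadicInt.coe_one]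
  exact hcpow

end Ratio

/-! ### 4. The realised sub-case of stub (P2) -/

section Realised

variable {F : Type} [Field F] [NumberField F] {p : ℕ} [Fact p.Prime]

/-- The embedding `𝒪_L ⊆ L ⊆ ℚ̄_p` is injective. [folklore] -/
theorem coe_comp_subtype_injective (L : IntermediateField ℚ_[p] (PadicAlgCl p)) :
    Function.Injective ((algebraMap L (PadicAlgCl p)).comp (intermediateFieldIntegers p L).subtype) :=
  fun _ _ h => Subtype.ext ((algebraMap L (PadicAlgCl p)).injective h)

/-- **The realised sub-case of (P2), sharp form.**  Let `M` be modelling data (`k` finite of characteristic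
`p`), `ψ : R_𝒟 → 𝒪_L` a ring homomorphism over which `𝒪_L` is integral (`L/ℚ_p` finite inside `ℚ̄_p`;
e.g. an `𝒪`-algebra map with `𝒪_L ⊇ 𝒪` finite), whose composite `φ : R_𝒟 → ℚ̄_p` realises the IRREDUCIBLE
continuous `r : Γ_F → GL₂(ℚ̄_p)` up to conjugation, `r` `p`-adically automorphic of tame level `𝒰` and
ORDINARY of parallel weight `k ≥ 2` at every `v ∣ p` (upper triangular in some frame with inertial diagonal
`(ε^{k-1}·finite, finite)`).  Then `𝔭 = ker φ` is a PATCHING prime of `R_𝒟` — `dim R_𝒟/𝔭 = 1`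
(`ringKrullDim_quotient_ker_eq_one_of_isIntegral`), `𝔭 ∉ Z^red` (landed `Theorems.not_mem_reducibleLocus_ker`),
every ratio `ψ₁⁽ᵛ⁾/ψ₂⁽ᵛ⁾ mod 𝔭` of infinite order (`not_isOfFinOrder_ratio_mod_ker`) — and pro-modular at level
`𝒰` (the landed ENTRANCE `isProModularPrimeAt_ker_of_isPadicallyAutomorphic_intermediateFieldIntegers`).
[cite: SkinnerWiles1999, §4.1 p. 62 and §4.2] -/
theorem isPatchingPrime_ker_and_isProModularPrimeAt_ker (M : ModelData F p)
    (L : IntermediateField ℚ_[p] (PadicAlgCl p)) [FiniteDimensional ℚ_[p] L]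
    (ψ : M.𝓡.R →+* intermediateFieldIntegers p L) (hint : ψ.IsIntegral)
    (r : FramedGaloisRep F (PadicAlgCl p) 2) (P : GL (Fin 2) (PadicAlgCl p)) (hirr : r.toGaloisRep.IsIrreducible)
    (hreal : ∀ g, Matrix.GeneralLinearGroup.map
      (((algebraMap L (PadicAlgCl p)).comp (intermediateFieldIntegers p L).subtype).comp ψ) (M.𝓡.ρ g) =
        P⁻¹ * r g * P)
    (𝒰 : TameLevel 2 F p) (hr : 𝒰.IsPadicallyAutomorphic r)
    (hord : ∃ k : ℕ, 2 ≤ k ∧ ∃ m : ℕ, 0 < m ∧ ∀ v : HeightOneSpectrum (𝓞 F), (p : 𝓞 F) ∈ v.asIdeal →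
      ∃ Q : Matrix.GeneralLinearGroup (Fin 2) (PadicAlgCl p),
        ∀ σ, (Q⁻¹ * r.toLocal v σ * Q).val 1 0 = 0 ∧ (σ ∈ absInertia (v.adicCompletion F) →
          (Q⁻¹ * r.toLocal v σ * Q).val 1 1 ^ m = 1 ∧ (Q⁻¹ * r.toLocal v σ * Q).val 0 0 ^ m =
            algebraMap (Padic p) (PadicAlgCl p) (((GaloisRep.cyclotomicCharacter (v.adicCompletion F) p σ).val :
              PadicInt p) : Padic p) ^ ((k - 1) * m))) :
    IsPatchingPrime M.𝓡
        ⟨RingHom.ker (((algebraMap L (PadicAlgCl p)).comp (intermediateFieldIntegers p L).subtype).comp ψ),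
          RingHom.ker_isPrime _⟩ ∧
      IsProModularPrimeAt M.𝓡 𝒰
        ⟨RingHom.ker (((algebraMap L (PadicAlgCl p)).comp (intermediateFieldIntegers p L).subtype).comp ψ),
          RingHom.ker_isPrime _⟩ := by
  have hker : RingHom.ker (((algebraMap L (PadicAlgCl p)).comp (intermediateFieldIntegers p L).subtype).comp ψ) =
      RingHom.ker ψ :=
    RingHom.ker_comp_of_injective ψ (coe_comp_subtype_injective L)
  refine ⟨⟨?_, ?_, fun v hv => ?_⟩, ?_⟩
  · change ringKrullDim (M.𝓡.R ⧸
      RingHom.ker (((algebraMap L (PadicAlgCl p)).comp (intermediateFieldIntegers p L).subtype).comp ψ)) = 1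
    rw [hker]
    exact ringKrullDim_quotient_ker_eq_one_of_isIntegral L ψ hint
  · exact Summit.Langlands.Langlands.Theorems.not_mem_reducibleLocus_ker M.𝓡 _ r hirr P hreal
  · obtain ⟨k, hk, m, hm, hkm⟩ := hord
    obtain ⟨Q, hQ⟩ := hkm v hv
    exact not_isOfFinOrder_ratio_mod_ker M.𝓡 _ r P hreal hk hm v hv Q hQ
  · exact isProModularPrimeAt_ker_of_isPadicallyAutomorphic_intermediateFieldIntegers M.𝓡 𝒰 L ψ r P hreal hr

/-- **Registered sub-goal `stub_seedPatchingPrime_auxRealised` of stub (P2) `stub_seedPatchingPrime`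
(line `fine-selmer-codimension-two`, crux stmt-Langlands-12919): the REALISED sub-case.**  For ANY modelling
data `M`, any ring homomorphism `ψ : R_𝒟 → 𝒪_L` (`L/ℚ_p` finite inside `ℚ̄_p`) over which `𝒪_L` is
integral, whose composite `φ : R_𝒟 → 𝒪_L ⊆ ℚ̄_p` realises an irreducible continuous `r : Γ_F → GL₂(ℚ̄_p)` up
to conjugation, with `r` `p`-adically automorphic of some tame level `𝒰` and ordinary of parallel weight
`k ≥ 2` at every `v ∣ p` (the seed's ordinary clause minus its orientation inequality), `R_𝒟` has a prime —
namely `ker φ` — which is a patching prime AND pro-modular at some level.  The full stub then only needs to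
realise the seed's `r` by such a `ψ` on the model of `(ρ, ρ₀)` (Skinner–Wiles' transport of the residual
extension class, [SW, Prop. 4.2]). [cite: SkinnerWiles1999, §4.1 p. 62 and §4.2] -/
theorem stub_seedPatchingPrime_auxRealised :
    ∀ (F : Type) [Field F] [NumberField F] (p : ℕ) [Fact p.Prime] (M : ModelData F p) (L : IntermediateField ℚ_[p] (PadicAlgCl p)) [FiniteDimensional ℚ_[p] L] (ψ : M.𝓡.R →+* intermediateFieldIntegers p L), ψ.IsIntegral → ∀ (r : FramedGaloisRep F (PadicAlgCl p) 2) (P : GL (Fin 2) (PadicAlgCl p)), r.toGaloisRep.IsIrreducible → (∀ g, Matrix.GeneralLinearGroup.map (((algebraMap L (PadicAlgCl p)).comp (intermediateFieldIntegers p L).subtype).comp ψ) (M.𝓡.ρ g) = P⁻¹ * r g * P) → ∀ (𝒰 : TameLevel 2 F p), 𝒰.IsPadicallyAutomorphic r → (∃ k : ℕ, 2 ≤ k ∧ ∃ m : ℕ, 0 < m ∧ ∀ v : HeightOneSpectrum (𝓞 F), (p : 𝓞 F) ∈ v.asIdeal → ∃ Q : Matrix.GeneralLinearGroup (Fin 2)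 (PadicAlgCl p), ∀ σ, (Q⁻¹ * r.toLocal v σ * Q).val 1 0 = 0 ∧ (σ ∈ absInertia (v.adicCompletion F) → (Q⁻¹ * r.toLocal v σ * Q).val 1 1 ^ m = 1 ∧ (Q⁻¹ * r.toLocal v σ * Q).val 0 0 ^ m = algebraMap (Padic p) (PadicAlgCl p) (((GaloisRep.cyclotomicCharacter (v.adicCompletion F) p σ).val : PadicInt p) : Padic p) ^ ((k - 1) * m))) → ∃ 𝔭 : PrimeSpectrum M.𝓡.R, IsPatchingPrime M.𝓡 𝔭 ∧ IsProModularPrime M.𝓡 𝔭 := by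
  intro F _ _ p _ M L _ ψ hint r P hirr hreal 𝒰 hr hord
  obtain ⟨h1, h2⟩ := isPatchingPrime_ker_and_isProModularPrimeAt_ker M L ψ hint r P hirr hreal 𝒰 hr hord
  exact ⟨_, h1, 𝒰, h2⟩

end Realised

end

end Summit.Langlands.Langlands.Cruxes.ReducibleOrdinaryProModular.FineSelmerCodimensionTwo
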